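import Mathlib
import HarnessLib
import Summits.Ventures.LatticeQCDFlow.Scaling.PlaquetteSharedLinkPeeling

/-!
# LatticeQCDFlow / Scaling — peeling with the CLOSING link: `Z ≤ Z_B · M^{k−s} · M₂^s` for a ranked
# plaquette structure with a closing section of size `s`, in every dimension

HONEST FRAMING: exact (Metropolis-corrected) sampling algorithms for lattice gauge theory;
figures of merit are autocorrelation/cost numbers at stated couplings and volumes; no
continuum-physics claim.

Venture `LatticeQCDFlow` (cell pub-lqcd), topic `Scaling`, FANOUT row 30 (lean-1, GEN-26) — OUR WORK on
THEORY-2.md §4 row C5, the LOWER half of the volume law of the exact one-plaquette heat-bath sampler.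
`Scaling/PlaquettePeelingRank` (GEN-23) proved `Z_B = ∫ ∏_{p∈B} w(U_p) dHaar^{⊗E} = c^{#B}`
(`c = ∫ w dHaar`) for every RANKED collection `B` (top links `t`, `rank p < rank p'` whenever `t p` lies on
another `p' ∈ B`), by peeling the plaquette of maximal rank.  The lineage's scorecard then squeezes the
full partition function between `m^k Z_B` and `M^k Z_B` (`k = #Bᶜ`, `0 < m ≤ w ≤ M`), which is what the
CEILING `τ_int ≤ (M/m)^k − 1/2` uses.  Here is the sharper UPPER bound on `Z` that the FLOOR needs.

A CLOSING SECTION of `(B, t, rank)` is a set `S` of plaquettes OUTSIDE `B` with a map `u : S → B`,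
INJECTIVE on `S`, such that `t (u p')` is one of the four links of `p'` and `u p'` has the LARGEST rank
among the plaquettes of `B` whose top link lies on `p'` (strictly: `rank p < rank (u p')` for every other
such `p`).  Along any compatible generation order `p'` is CLOSED by the heat-bath draw of `t (u p')`: at
that moment `U_{p'} = P · H^{±1} · Q` with `H ~ (w/c)·Haar` fresh and `P, Q` already generated, so
`E[w(U_{p'}) | past] ≤ M₂`, the TWO-PLAQUETTE CONSTANT of `Scaling/PlaquetteSharedLinkPeeling`
(`∫ w(h) w(a h^{±1} b) dHaar(h) ≤ c·M₂` for all `a, b`; `M₂ ≤ M`, and `M₂ < M` unless `w` is constant).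
Peeling the maximal-rank plaquette `a` of `B` together with its partner `u⁻¹(a)` (if any):

* **`integral_prod_weight_mul_prod_closing_le`** — `∫ F_B · ∏_{p'∈S, u p' ∈ B} w(U_{p'}) ≤ c^{#B} M₂^{#S_B}`
  (induction on the maximal rank; `S_B = {p' ∈ S : u p' ∈ B}`);
* **`integral_prod_weight_le_of_closing`** — `Z ≤ c^{#B} · M^{k−s} · M₂^{s}` when `u(S) ⊆ B` (`s = #S`):
  against the squeeze `Z ≤ c^{#B} M^k` every closed uncovered plaquette trades a factor `M` for `M₂`;
* **`integral_prod_weight_div_le_of_closing`** — `Z/Z_B ≤ M^{k−s} M₂^{s}`, i.e. `E_{q_B}[F_R] ≤ M^{k−s} M₂^s`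
  for the block proposal `q_B = (F_B/Z_B)·Haar^{⊗E}` of the lineage's scorecard.

The sequels give the closing sections of the optimal structures (`s ≥ k/(2d−3)`) and turn the bound
into a `τ_int` floor of order `(M/M₂)^s` for the exact sampler.  No `def`, no `sorry`, nothing cited as a
fact.
-/

noncomputable section

namespace Summit.Ventures.LatticeQCDFlow.Theory2.Autoregressive

open MeasureTheory Function Finset
open Literature.MathematicalPhysics.QuantumFieldTheory Literature.MathematicalPhysics.QuantumLattice
open Summit.Ventures.LatticeQCDFlow.Exactness

variable {d L : ℕ} [NeZero L] {G : Type*} [Group G] [TopologicalSpace G] [IsTopologicalGroup G]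
  [CompactSpace G] [SecondCountableTopology G] [MeasurableSpace G] [BorelSpace G]

/-! ## Peeling a ranked structure together with a closing section -/

/-- **The closing-section peeling bound.**  `L ≥ 2`; `w` continuous, `0 < m ≤ w ≤ M`, `c = ∫ w dHaar`;
`∫ w(h) w(a h^{±1} b) dHaar ≤ c·M₂` for all `a, b`.  `(B, t, rank)` ranked (`t p` a link of `p ∈ B`,
`rank p < rank p'` when `t p` lies on another `p' ∈ B`).  `S` a set of plaquettes disjoint from `B` with
`u : S → plaquettes` INJECTIVE on `S`, `t (u p')` a link of `p'`, and `rank p < rank (u p')` for every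
OTHER `p ∈ B` whose top link lies on `p'`.  Then
`∫ (∏_{p∈B} w(U_p)) · ∏_{p' ∈ S, u p' ∈ B} w(U_{p'}) dHaar^{⊗E} ≤ c^{#B} · M₂^{#{p' ∈ S : u p' ∈ B}}`:
peel the maximal-rank plaquette of `B` together with its `u`-partner. [ours] -/
theorem integral_prod_weight_mul_prod_closing_le (hL : 2 ≤ L) {w : G → ℝ} (hw : Continuous w)
    {m M : ℝ} (hm0 : 0 < m) (hm : ∀ g, m ≤ w g) (hM : ∀ g, w g ≤ M) {M₂ : ℝ}
    (hM₂ : ∀ a b : G, ∫ h, w h * w (a * h * b) ∂(haarProbability G) ≤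
      (∫ g, w g ∂(haarProbability G)) * M₂)
    (hM₂' : ∀ a b : G, ∫ h, w h * w (a * h⁻¹ * b) ∂(haarProbability G) ≤
      (∫ g, w g ∂(haarProbability G)) * M₂)
    (B : Finset (Plaquette d L)) (t : Plaquette d L → Edge d L)
    (ht : ∀ p ∈ B, t p ∈ ({(p.1, p.2.1.1), (p.1.shift p.2.1.1, p.2.1.2),
        (p.1.shift p.2.1.2, p.2.1.1), (p.1, p.2.1.2)} : Finset (Edge d L)))
    (rank : Plaquette d L → ℕ)
    (hrank : ∀ p ∈ B, ∀ p' ∈ B, p ≠ p' → t p ∈ ({(p'.1, p'.2.1.1), (p'.1.shift p'.2.1.1, p'.2.1.2),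
        (p'.1.shift p'.2.1.2, p'.2.1.1), (p'.1, p'.2.1.2)} : Finset (Edge d L)) → rank p < rank p')
    (S : Finset (Plaquette d L)) (u : Plaquette d L → Plaquette d L) (hSB : ∀ p' ∈ S, p' ∉ B)
    (hut : ∀ p' ∈ S, t (u p') ∈ ({(p'.1, p'.2.1.1), (p'.1.shift p'.2.1.1, p'.2.1.2),
        (p'.1.shift p'.2.1.2, p'.2.1.1), (p'.1, p'.2.1.2)} : Finset (Edge d L)))
    (humax : ∀ p' ∈ S, ∀ p ∈ B, p ≠ u p' → t p ∈ ({(p'.1, p'.2.1.1), (p'.1.shift p'.2.1.1, p'.2.1.2),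
        (p'.1.shift p'.2.1.2, p'.2.1.1), (p'.1, p'.2.1.2)} : Finset (Edge d L)) → rank p < rank (u p'))
    (huinj : Set.InjOn u S) :
    ∫ U, (∏ p ∈ B, w (plaquetteHolonomy U p.1 p.2.1.1 p.2.1.2)) *
        ∏ p' ∈ S.filter (fun p' => u p' ∈ B), w (plaquetteHolonomy U p'.1 p'.2.1.1 p'.2.1.2)
        ∂(Measure.pi fun _ : Edge d L => haarProbability G) ≤
      (∫ g, w g ∂(haarProbability G)) ^ B.card * M₂ ^ (S.filter (fun p' => u p' ∈ B)).card := by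
  classical
  have hw0 : ∀ g, 0 < w g := fun g => hm0.trans_le (hm g)
  have hMpos : 0 < M := (hw0 1).trans_le (hM 1)
  have hwb : ∀ g, |w g| ≤ M := fun g => by rw [abs_of_pos (hw0 g)]; exact hM g
  have hc : 0 < ∫ g, w g ∂(haarProbability G) := haarProbability_integral_pos_of_continuous_pos hw hw0
  have hM₂0 : 0 ≤ M₂ := by
    have h1 := hM₂ 1 1
    have h0 : 0 ≤ ∫ h, w h * w (1 * h * 1) ∂(haarProbability G) :=
      integral_nonneg fun h => mul_nonneg (hw0 _).le (hw0 _).le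
    exact (mul_nonneg_iff_of_pos_left hc).1 (h0.trans h1)
  revert ht hrank hSB humax
  refine Finset.induction_on_max_value rank B ?_ ?_
  · intro _ _ _ _
    simp
  · intro a s has hmax ih ht hrank hSB humax
    have hta := ht a (Finset.mem_insert_self a s)
    have hts : ∀ p ∈ s, t p ∈ ({(p.1, p.2.1.1), (p.1.shift p.2.1.1, p.2.1.2),
        (p.1.shift p.2.1.2, p.2.1.1), (p.1, p.2.1.2)} : Finset (Edge d L)) :=
      fun p hp => ht p (Finset.mem_insert_of_mem hp)
    have hranks : ∀ p ∈ s, ∀ p' ∈ s, p ≠ p' → t p ∈ ({(p'.1, p'.2.1.1), (p'.1.shift p'.2.1.1, p'.2.1.2),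
        (p'.1.shift p'.2.1.2, p'.2.1.1), (p'.1, p'.2.1.2)} : Finset (Edge d L)) → rank p < rank p' :=
      fun p hp p' hp' => hrank p (Finset.mem_insert_of_mem hp) p' (Finset.mem_insert_of_mem hp')
    have hSBs : ∀ p' ∈ S, p' ∉ s := fun p' hp' h => hSB p' hp' (Finset.mem_insert_of_mem h)
    have humaxs : ∀ p' ∈ S, ∀ p ∈ s, p ≠ u p' → t p ∈ ({(p'.1, p'.2.1.1), (p'.1.shift p'.2.1.1, p'.2.1.2),
        (p'.1.shift p'.2.1.2, p'.2.1.1), (p'.1, p'.2.1.2)} : Finset (Edge d L)) → rank p < rank (u p') :=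
      fun p' hp' p hp => humax p' hp' p (Finset.mem_insert_of_mem hp)
    have ih' := ih hts hranks hSBs humaxs
    -- the top link of `a` lies on no plaquette of `s` (maximality of `rank a`)
    have hfree : ∀ p ∈ s, t a ∉ ({(p.1, p.2.1.1), (p.1.shift p.2.1.1, p.2.1.2),
        (p.1.shift p.2.1.2, p.2.1.1), (p.1, p.2.1.2)} : Finset (Edge d L)) := by
      intro p hp hmem
      have hne : a ≠ p := fun h => has (h ▸ hp)
      have := hrank a (Finset.mem_insert_self a s) p (Finset.mem_insert_of_mem hp) hne hmem
      exact absurd (hmax p hp) (not_le.2 this)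
    -- … and on no plaquette of `S` whose partner lies in `s` (maximality of the partner's rank)
    have hfreeS : ∀ p' ∈ S.filter (fun p' => u p' ∈ s), t a ∉ ({(p'.1, p'.2.1.1),
        (p'.1.shift p'.2.1.1, p'.2.1.2), (p'.1.shift p'.2.1.2, p'.2.1.1), (p'.1, p'.2.1.2)} :
          Finset (Edge d L)) := by
      intro p' hp' hmem
      rw [Finset.mem_filter] at hp'
      have hne : a ≠ u p' := fun h => has (h ▸ hp'.2)
      have h1 := humax p' hp'.1 a (Finset.mem_insert_self a s) hne hmem
      exact absurd (hmax (u p') hp'.2) (not_le.2 h1)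
    -- the remaining product is blind to the link `t a`
    set Φ : GaugeConfig d L G → ℝ := fun U =>
      (∏ p ∈ s, w (plaquetteHolonomy U p.1 p.2.1.1 p.2.1.2)) *
        ∏ p' ∈ S.filter (fun p' => u p' ∈ s), w (plaquetteHolonomy U p'.1 p'.2.1.1 p'.2.1.2) with hΦ
    have hΦe : ∀ U v, Φ (update U (t a) v) = Φ U := by
      intro U v
      simp only [hΦ]
      congr 1
      · refine Finset.prod_congr rfl fun p hp => ?_
        have h := hfree p hp
        simp only [Finset.mem_insert, Finset.mem_singleton, not_or] at h
        obtain ⟨h1, h2, h3, h4⟩ := h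
        rw [plaquetteHolonomy_update_of_ne U v (Ne.symm h1) (Ne.symm h2) (Ne.symm h3) (Ne.symm h4)]
      · refine Finset.prod_congr rfl fun p' hp' => ?_
        have h := hfreeS p' hp'
        simp only [Finset.mem_insert, Finset.mem_singleton, not_or] at h
        obtain ⟨h1, h2, h3, h4⟩ := h
        rw [plaquetteHolonomy_update_of_ne U v (Ne.symm h1) (Ne.symm h2) (Ne.symm h3) (Ne.symm h4)]
    have hΦm : Measurable Φ :=
      (Finset.measurable_prod s fun p _ =>
        hw.measurable.comp (measurable_plaquetteHolonomy p.1 p.2.1.1 p.2.1.2)).mul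
      (Finset.measurable_prod _ fun p' _ =>
        hw.measurable.comp (measurable_plaquetteHolonomy p'.1 p'.2.1.1 p'.2.1.2))
    have hΦpos : ∀ U, 0 < Φ U := fun U =>
      mul_pos (prod_pos fun p _ => hw0 _) (prod_pos fun p _ => hw0 _)
    have hΦb : ∀ U, |Φ U| ≤ M ^ s.card * M ^ (S.filter (fun p' => u p' ∈ s)).card := by
      intro U
      rw [abs_of_pos (hΦpos U), hΦ]
      refine mul_le_mul ?_ ?_ (prod_pos fun p _ => hw0 _).le (pow_nonneg hMpos.le _)
      · rw [← Finset.prod_const]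
        exact Finset.prod_le_prod (fun p _ => (hw0 _).le) fun p _ => hM _
      · rw [← Finset.prod_const]
        exact Finset.prod_le_prod (fun p _ => (hw0 _).le) fun p _ => hM _
    -- split the closing product at `a`
    have hsplit : S.filter (fun p' => u p' ∈ insert a s) =
        S.filter (fun p' => u p' = a) ∪ S.filter (fun p' => u p' ∈ s) := by
      ext p'
      simp only [Finset.mem_filter, Finset.mem_insert, Finset.mem_union]
      tauto
    have hdisj : Disjoint (S.filter (fun p' => u p' = a)) (S.filter (fun p' => u p' ∈ s)) :=
      Finset.disjoint_filter.2 fun p' _ h1 h2 => has (h1 ▸ h2)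
    rw [hsplit, Finset.card_union_of_disjoint hdisj, Finset.card_insert_of_notMem has]
    simp_rw [Finset.prod_union hdisj, Finset.prod_insert has]
    by_cases hex : ∃ p' ∈ S, u p' = a
    · -- `a` has a partner `pa ∈ S`: peel both at the shared link `t a`
      obtain ⟨pa, hpaS, hupa⟩ := hex
      have hfa : S.filter (fun p' => u p' = a) = {pa} := by
        ext p'
        simp only [Finset.mem_filter, Finset.mem_singleton]
        constructor
        · rintro ⟨hp', h⟩; exact huinj hp' hpaS (h.trans hupa.symm)
        · rintro rfl; exact ⟨hpaS, hupa⟩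
      rw [hfa, Finset.card_singleton]
      simp_rw [Finset.prod_singleton]
      have hta' : t a ∈ ({(pa.1, pa.2.1.1), (pa.1.shift pa.2.1.1, pa.2.1.2),
          (pa.1.shift pa.2.1.2, pa.2.1.1), (pa.1, pa.2.1.2)} : Finset (Edge d L)) := by
        have h := hut pa hpaS; rwa [hupa] at h
      have hstep := integral_weight_mul_weight_mul_le (G := G) hL a.1 (ne_of_lt a.2.2) pa.1
        (ne_of_lt pa.2.2) hta hta' hw.measurable hw0 hM hM₂ hM₂' hΦm hΦb (fun U => (hΦpos U).le) hΦe
      calc ∫ U, w (plaquetteHolonomy U a.1 a.2.1.1 a.2.1.2) *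
              (∏ p ∈ s, w (plaquetteHolonomy U p.1 p.2.1.1 p.2.1.2)) *
              (w (plaquetteHolonomy U pa.1 pa.2.1.1 pa.2.1.2) *
                ∏ p' ∈ S.filter (fun p' => u p' ∈ s), w (plaquetteHolonomy U p'.1 p'.2.1.1 p'.2.1.2))
              ∂(Measure.pi fun _ : Edge d L => haarProbability G)
          = ∫ U, w (plaquetteHolonomy U a.1 a.2.1.1 a.2.1.2) *
              w (plaquetteHolonomy U pa.1 pa.2.1.1 pa.2.1.2) * Φ U
              ∂(Measure.pi fun _ : Edge d L => haarProbability G) := by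
            refine integral_congr_ae (ae_of_all _ fun U => ?_)
            simp only [hΦ]; ring
        _ ≤ (∫ g, w g ∂(haarProbability G)) * M₂ *
              ∫ U, Φ U ∂(Measure.pi fun _ : Edge d L => haarProbability G) := hstep
        _ ≤ (∫ g, w g ∂(haarProbability G)) * M₂ *
              ((∫ g, w g ∂(haarProbability G)) ^ s.card * M₂ ^ (S.filter (fun p' => u p' ∈ s)).card) :=
            mul_le_mul_of_nonneg_left ih' (mul_nonneg hc.le hM₂0)
        _ = (∫ g, w g ∂(haarProbability G)) ^ (s.card + 1) *
              M₂ ^ (1 + (S.filter (fun p' => u p' ∈ s)).card) := by ring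
    · -- no partner: peel `a` alone (`Z`-peeling of GEN-23)
      have hfa : S.filter (fun p' => u p' = a) = ∅ := by
        ext p'
        simp only [Finset.mem_filter, Finset.notMem_empty, iff_false, not_and]
        exact fun hp' h => hex ⟨p', hp', h⟩
      rw [hfa, Finset.card_empty, zero_add]
      simp_rw [Finset.prod_empty]
      calc ∫ U, w (plaquetteHolonomy U a.1 a.2.1.1 a.2.1.2) *
              (∏ p ∈ s, w (plaquetteHolonomy U p.1 p.2.1.1 p.2.1.2)) *
              (1 * ∏ p' ∈ S.filter (fun p' => u p' ∈ s), w (plaquetteHolonomy U p'.1 p'.2.1.1 p'.2.1.2))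
              ∂(Measure.pi fun _ : Edge d L => haarProbability G)
          = ∫ U, w (plaquetteHolonomy U a.1 a.2.1.1 a.2.1.2) * Φ U
              ∂(Measure.pi fun _ : Edge d L => haarProbability G) := by
            refine integral_congr_ae (ae_of_all _ fun U => ?_)
            simp only [hΦ]; ring
        _ = (∫ g, w g ∂(haarProbability G)) *
              ∫ U, Φ U ∂(Measure.pi fun _ : Edge d L => haarProbability G) :=
            integral_comp_plaquetteHolonomy_mul_of_mem hL a.1 (ne_of_lt a.2.2) hta hw.measurable hwb hΦm
              hΦb hΦe
        _ ≤ (∫ g, w g ∂(haarProbability G)) *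
              ((∫ g, w g ∂(haarProbability G)) ^ s.card * M₂ ^ (S.filter (fun p' => u p' ∈ s)).card) :=
            mul_le_mul_of_nonneg_left ih' hc.le
        _ = (∫ g, w g ∂(haarProbability G)) ^ (s.card + 1) *
              M₂ ^ (S.filter (fun p' => u p' ∈ s)).card := by ring

/-- **`Z ≤ c^{#B} · M^{k−s} · M₂^{s}`.**  Same setting, with the closing section landing in `B`
(`u p' ∈ B` for every `p' ∈ S`; `k = #Bᶜ`, `s = #S`): the FULL partition function
`Z = ∫ ∏_{all p} w(U_p) dHaar^{⊗E}` is at most `c^{#B} M^{k−s} M₂^{s}` — against the squeeze `Z ≤ c^{#B} M^k`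
of the lineage's scorecard, every closed uncovered plaquette trades a factor `M` for `M₂`. [ours] -/
theorem integral_prod_weight_le_of_closing (hL : 2 ≤ L) {w : G → ℝ} (hw : Continuous w)
    {m M : ℝ} (hm0 : 0 < m) (hm : ∀ g, m ≤ w g) (hM : ∀ g, w g ≤ M) {M₂ : ℝ}
    (hM₂ : ∀ a b : G, ∫ h, w h * w (a * h * b) ∂(haarProbability G) ≤
      (∫ g, w g ∂(haarProbability G)) * M₂)
    (hM₂' : ∀ a b : G, ∫ h, w h * w (a * h⁻¹ * b) ∂(haarProbability G) ≤
      (∫ g, w g ∂(haarProbability G)) * M₂)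
    (B : Finset (Plaquette d L)) (t : Plaquette d L → Edge d L)
    (ht : ∀ p ∈ B, t p ∈ ({(p.1, p.2.1.1), (p.1.shift p.2.1.1, p.2.1.2),
        (p.1.shift p.2.1.2, p.2.1.1), (p.1, p.2.1.2)} : Finset (Edge d L)))
    (rank : Plaquette d L → ℕ)
    (hrank : ∀ p ∈ B, ∀ p' ∈ B, p ≠ p' → t p ∈ ({(p'.1, p'.2.1.1), (p'.1.shift p'.2.1.1, p'.2.1.2),
        (p'.1.shift p'.2.1.2, p'.2.1.1), (p'.1, p'.2.1.2)} : Finset (Edge d L)) → rank p < rank p')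
    (S : Finset (Plaquette d L)) (u : Plaquette d L → Plaquette d L) (hSB : ∀ p' ∈ S, p' ∉ B)
    (huB : ∀ p' ∈ S, u p' ∈ B)
    (hut : ∀ p' ∈ S, t (u p') ∈ ({(p'.1, p'.2.1.1), (p'.1.shift p'.2.1.1, p'.2.1.2),
        (p'.1.shift p'.2.1.2, p'.2.1.1), (p'.1, p'.2.1.2)} : Finset (Edge d L)))
    (humax : ∀ p' ∈ S, ∀ p ∈ B, p ≠ u p' → t p ∈ ({(p'.1, p'.2.1.1), (p'.1.shift p'.2.1.1, p'.2.1.2),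
        (p'.1.shift p'.2.1.2, p'.2.1.1), (p'.1, p'.2.1.2)} : Finset (Edge d L)) → rank p < rank (u p'))
    (huinj : Set.InjOn u S) :
    ∫ U, ∏ p : Plaquette d L, w (plaquetteHolonomy U p.1 p.2.1.1 p.2.1.2)
        ∂(Measure.pi fun _ : Edge d L => haarProbability G) ≤
      (∫ g, w g ∂(haarProbability G)) ^ B.card * M ^ ((Finset.univ \ B).card - S.card) *
        M₂ ^ S.card := by
  classical
  have hw0 : ∀ g, 0 < w g := fun g => hm0.trans_le (hm g)
  have hMpos : 0 < M := (hw0 1).trans_le (hM 1)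
  have hSsub : S ⊆ Finset.univ \ B := fun p' hp' => Finset.mem_sdiff.2 ⟨Finset.mem_univ _, hSB p' hp'⟩
  have hfilt : S.filter (fun p' => u p' ∈ B) = S := Finset.filter_true_of_mem fun p' hp' => huB p' hp'
  have hkey := integral_prod_weight_mul_prod_closing_le (G := G) hL hw hm0 hm hM hM₂ hM₂' B t ht rank
    hrank S u hSB hut humax huinj
  rw [hfilt] at hkey
  set FB : GaugeConfig d L G → ℝ := fun U => ∏ p ∈ B, w (plaquetteHolonomy U p.1 p.2.1.1 p.2.1.2)
    with hFB
  set FS : GaugeConfig d L G → ℝ := fun U => ∏ p ∈ S, w (plaquetteHolonomy U p.1 p.2.1.1 p.2.1.2)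
    with hFS
  set FO : GaugeConfig d L G → ℝ := fun U =>
    ∏ p ∈ (Finset.univ \ B) \ S, w (plaquetteHolonomy U p.1 p.2.1.1 p.2.1.2) with hFO
  have hsplit : ∀ U, (∏ p : Plaquette d L, w (plaquetteHolonomy U p.1 p.2.1.1 p.2.1.2)) =
      FO U * (FB U * FS U) := by
    intro U
    rw [← Finset.prod_sdiff (Finset.subset_univ B), ← Finset.prod_sdiff hSsub, hFO, hFB, hFS]
    ring
  have hcard : ((Finset.univ \ B) \ S).card = (Finset.univ \ B).card - S.card :=
    Finset.card_sdiff_of_subset hSsub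
  have hFOle : ∀ U, FO U ≤ M ^ ((Finset.univ \ B).card - S.card) := by
    intro U
    rw [hFO, ← hcard, ← Finset.prod_const]
    exact Finset.prod_le_prod (fun p _ => (hw0 _).le) fun p _ => hM _
  have hprodpos : ∀ U, 0 < FB U * FS U := fun U =>
    mul_pos (prod_pos fun p _ => hw0 _) (prod_pos fun p _ => hw0 _)
  have hmeas : Measurable fun U : GaugeConfig d L G => FB U * FS U :=
    (Finset.measurable_prod B fun p _ =>
      hw.measurable.comp (measurable_plaquetteHolonomy p.1 p.2.1.1 p.2.1.2)).mul
    (Finset.measurable_prod S fun p _ =>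
      hw.measurable.comp (measurable_plaquetteHolonomy p.1 p.2.1.1 p.2.1.2))
  haveI : IsProbabilityMeasure (Measure.pi fun _ : Edge d L => haarProbability G) := by infer_instance
  have hint : Integrable (fun U : GaugeConfig d L G => FB U * FS U)
      (Measure.pi fun _ : Edge d L => haarProbability G) := by
    refine Integrable.mono' (integrable_const (M ^ B.card * M ^ S.card)) hmeas.aestronglyMeasurable
      (ae_of_all _ fun U => ?_)
    rw [Real.norm_eq_abs, abs_of_pos (hprodpos U), hFB, hFS]
    refine mul_le_mul ?_ ?_ (prod_pos fun p _ => hw0 _).le (pow_nonneg hMpos.le _)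
    · rw [← Finset.prod_const]
      exact Finset.prod_le_prod (fun p _ => (hw0 _).le) fun p _ => hM _
    · rw [← Finset.prod_const]
      exact Finset.prod_le_prod (fun p _ => (hw0 _).le) fun p _ => hM _
  calc ∫ U, ∏ p : Plaquette d L, w (plaquetteHolonomy U p.1 p.2.1.1 p.2.1.2)
          ∂(Measure.pi fun _ : Edge d L => haarProbability G)
      = ∫ U, FO U * (FB U * FS U) ∂(Measure.pi fun _ : Edge d L => haarProbability G) := by
        simp_rw [hsplit]
    _ ≤ ∫ U, M ^ ((Finset.univ \ B).card - S.card) * (FB U * FS U)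
          ∂(Measure.pi fun _ : Edge d L => haarProbability G) :=
        integral_mono_of_nonneg
          (ae_of_all _ fun U => mul_nonneg (prod_pos fun p _ => hw0 _).le (hprodpos U).le)
          (hint.const_mul _)
          (ae_of_all _ fun U => mul_le_mul_of_nonneg_right (hFOle U) (hprodpos U).le)
    _ = M ^ ((Finset.univ \ B).card - S.card) *
          ∫ U, FB U * FS U ∂(Measure.pi fun _ : Edge d L => haarProbability G) := integral_const_mul _ _
    _ ≤ M ^ ((Finset.univ \ B).card - S.card) * ((∫ g, w g ∂(haarProbability G)) ^ B.card * M₂ ^ S.card) :=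
        mul_le_mul_of_nonneg_left hkey (pow_nonneg hMpos.le _)
    _ = (∫ g, w g ∂(haarProbability G)) ^ B.card * M ^ ((Finset.univ \ B).card - S.card) *
          M₂ ^ S.card := by ring

/-- **`Z/Z_B ≤ M^{k−s} · M₂^{s}`** — the normalising constant of the block-proposal density ratio
(`E_{q_B}[F_R] = Z/Z_B`, GEN-24's `ρ⁻¹(U) = Z_B F_R(U)/Z`), with `Z_B = c^{#B}` by GEN-23's peeling.
[ours] -/
theorem integral_prod_weight_div_le_of_closing (hL : 2 ≤ L) {w : G → ℝ} (hw : Continuous w)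
    {m M : ℝ} (hm0 : 0 < m) (hm : ∀ g, m ≤ w g) (hM : ∀ g, w g ≤ M) {M₂ : ℝ}
    (hM₂ : ∀ a b : G, ∫ h, w h * w (a * h * b) ∂(haarProbability G) ≤
      (∫ g, w g ∂(haarProbability G)) * M₂)
    (hM₂' : ∀ a b : G, ∫ h, w h * w (a * h⁻¹ * b) ∂(haarProbability G) ≤
      (∫ g, w g ∂(haarProbability G)) * M₂)
    (B : Finset (Plaquette d L)) (t : Plaquette d L → Edge d L)
    (ht : ∀ p ∈ B, t p ∈ ({(p.1, p.2.1.1), (p.1.shift p.2.1.1, p.2.1.2),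
        (p.1.shift p.2.1.2, p.2.1.1), (p.1, p.2.1.2)} : Finset (Edge d L)))
    (rank : Plaquette d L → ℕ)
    (hrank : ∀ p ∈ B, ∀ p' ∈ B, p ≠ p' → t p ∈ ({(p'.1, p'.2.1.1), (p'.1.shift p'.2.1.1, p'.2.1.2),
        (p'.1.shift p'.2.1.2, p'.2.1.1), (p'.1, p'.2.1.2)} : Finset (Edge d L)) → rank p < rank p')
    (S : Finset (Plaquette d L)) (u : Plaquette d L → Plaquette d L) (hSB : ∀ p' ∈ S, p' ∉ B)
    (huB : ∀ p' ∈ S, u p' ∈ B)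
    (hut : ∀ p' ∈ S, t (u p') ∈ ({(p'.1, p'.2.1.1), (p'.1.shift p'.2.1.1, p'.2.1.2),
        (p'.1.shift p'.2.1.2, p'.2.1.1), (p'.1, p'.2.1.2)} : Finset (Edge d L)))
    (humax : ∀ p' ∈ S, ∀ p ∈ B, p ≠ u p' → t p ∈ ({(p'.1, p'.2.1.1), (p'.1.shift p'.2.1.1, p'.2.1.2),
        (p'.1.shift p'.2.1.2, p'.2.1.1), (p'.1, p'.2.1.2)} : Finset (Edge d L)) → rank p < rank (u p'))
    (huinj : Set.InjOn u S) :
    (∫ U, ∏ p : Plaquette d L, w (plaquetteHolonomy U p.1 p.2.1.1 p.2.1.2)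
        ∂(Measure.pi fun _ : Edge d L => haarProbability G)) /
      (∫ U, ∏ p ∈ B, w (plaquetteHolonomy U p.1 p.2.1.1 p.2.1.2)
        ∂(Measure.pi fun _ : Edge d L => haarProbability G)) ≤
      M ^ ((Finset.univ \ B).card - S.card) * M₂ ^ S.card := by
  have hw0 : ∀ g, 0 < w g := fun g => hm0.trans_le (hm g)
  have hc : 0 < ∫ g, w g ∂(haarProbability G) := haarProbability_integral_pos_of_continuous_pos hw hw0
  rw [integral_prod_weight_eq_pow_of_rank (G := G) hL hw hm0 hm hM B t ht rank hrank,
    div_le_iff₀ (pow_pos hc _)]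
  calc ∫ U, ∏ p : Plaquette d L, w (plaquetteHolonomy U p.1 p.2.1.1 p.2.1.2)
          ∂(Measure.pi fun _ : Edge d L => haarProbability G)
      ≤ (∫ g, w g ∂(haarProbability G)) ^ B.card * M ^ ((Finset.univ \ B).card - S.card) *
          M₂ ^ S.card :=
        integral_prod_weight_le_of_closing (G := G) hL hw hm0 hm hM hM₂ hM₂' B t ht rank hrank S u hSB
          huB hut humax huinj
    _ = M ^ ((Finset.univ \ B).card - S.card) * M₂ ^ S.card *
          (∫ g, w g ∂(haarProbability G)) ^ B.card := by ring

end Summit.Ventures.LatticeQCDFlow.Theory2.Autoregressive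

end
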